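import Summits.Ventures.Crystal3D.Theorems.StickyWulffConstantCoaxialWallLawFluxGapTwin
import Summits.Ventures.Crystal3D.Theorems.StickyWulffConstantCoaxialWallLawFluxGapTrans
import HarnessLib

/-!
# The flux-gap rung of `stub_coaxialTwoSlabAdhesion`: all co-axial pairs, general fillings, modulo foreign twin dozens

HONEST FRAMING. Part of the venture `Summits/Ventures/Crystal3D` (cell `crystal3d-full`), helper
`--supports` the crux `CoaxialWallLaw` (stmt-Ventures-19481, `route-Ventures-StickyWulffConstant`),
REGISTERED line `WallLedgerF` (planner cf-p1 gen 16), open stub `stub_coaxialTwoSlabAdhesion`.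
RUNG CREDIT ONLY — NOT the stub.  Capstone (brick 15) of the FLUX-GAP / beam-expansion architecture
(memo F-FLUXGAP-ARCH, evidence #7 on the crux item; bricks `…ExitCountBelow`, `…TerracePropagation`,
`…FluxGap`, `…Automaton`, `…AutomatonCount`, `…AutomatonEnds`, `…AutomatonTrans`, `…AutomatonCore`,
`…InteriorLedger`, `…BandCount`, `…Sources`, `…TwinFrames`, `…FluxGapCell`, `…FluxGapCellTrans`,
`…FluxGapTwin`, `…FluxGapTrans`).

**Theorem (`coaxialTwoSlabAdhesion_general_fluxGap`).**  Let `Λᵢ = Aᵢ·Λ₀ + tᵢ` carry the crux's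
co-axiality data (`L, s₁, s₂, σ, σ'` — the stub's literal hypothesis, opened), `Λ₁ ≠ Λ₂` (the stub's
hypothesis) and `cos²θ = ⟪L e₃, e₃⟫² ≥ 9/25`.  Then there are `C` and `R₀ = 10` such that for EVERY
`h ≥ 0`, `ρ ≥ R₀` and EVERY `1`-separated filling `X` of the cell `{−2R₀ ≤ x₂ ≤ h + 2R₀, lateral ≤ ρ}`
containing the two complete slab samples `P₁ ⊆ X`, `P₂ ⊆ X ∖ P₁` (kissing facts `KissingGap δ`,
`KissingClassification δ` by name):

  `cross(P₁, X∖P₁) + cross(P₂, Y) ≤ D(Y) + (φ₁ + φ₂ − (√6/156)·sin θ) π ρ² + (1/26)·#FOREIGN(X) + C (1 + h) ρ`,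

`Y = (X∖P₁)∖P₂`, `sin θ = √(1 − ⟪L e₃, e₃⟫²)`, where `FOREIGN(X)` is the set of balls `b ∈ X` that are
FOREIGN TWIN DOZENS: for a frame `G ∈ {L, L∘R}` (`R` the half-turn about `e₃`) and a unit normal `n'`
with `⟪G w, n'⟫ ∈ {0, ±√(2/3)}` on the slots (a `{111}` normal of `G`) OTHER than `±L e₃`, the closed
lower half-dozen `{b + G w : ⟪G w, n'⟫ ≤ 0}` lies in `X`, the open upper half-dozen misses `X`, and the
mirror images `b + G w − 2⟪G w, n'⟫ n'` (`⟪G w, n'⟫ < 0`) lie in `X` — i.e. `b` sits on a coherent twin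
plate of one of the two grains' frames across a `{111}` plane that is NOT the lamination plane.
Twin pairs (`σ 0 ≠ σ' 0`): `coaxialTwoSlabAdhesion_general_twin_fluxGap`; translation pairs
(`σ 0 = σ' 0`): `coaxialTwoSlabAdhesion_general_trans_fluxGap`; the letters decide because `Λ₀ ≠ R·Λ₀`
(`fcc_ne_halfTurn_image`).

WHAT THE RESIDUAL MEANS (honest).  `#FOREIGN` is NOT controlled by the deficiency: a DECORATIVE coherent
twin lamella on a foreign `{111}` plane inside grain 1 costs `O(ρ)` broken bonds (only where it ends) but
puts `~ρ²` balls into `FOREIGN`.  So this rung does not imply the stub; what it isolates is the NET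
problem — the automaton's lines must be continued THROUGH foreign variants (classes indexed by words in
the twin tree, designated slot = mirror of the best negative slot, injectivity by the rigidity of adjacent
full shells), whose two open points are (α) designated moves may DESCEND inside a foreign class when the
foreign normal is nearly horizontal, (β) such lines can end unpaid on the top face of the bottom sample.
REGIME.  `cos²θ ≥ 9/25` (shared axis within `53°` of `e₃`) makes every far slot of both classes rise; the
complement (basal planes steep or edge-on) is the prism-zone geometry of cf-p1's CORRECTION line (gen 24),
where per-row capacities, not a beam, are the natural ledger.

WHAT THIS IS NOT: the stub (residual, regime, constant `√6/156 < ½`); F-C1 not moved.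
-/

noncomputable section

namespace Summit.Ventures.Crystal3D.Theorems

open Summit.Ventures.Crystal3D Finset
open Literature.MathematicalPhysics.StatisticalMechanics (fccStacking barlowStacking IsHaggSeq
  contactDeficiency)
open scoped InnerProductSpace

/-- **The model lattice is not its own twin**: `Λ₀ ≠ R·Λ₀` for the half-turn `R` about `e₃`
(a far slot `u` of `e₃` has `u₂ ≠ 0`, and `R u` is not a slot, `halfTurn_notMem_fccSlots`). -/
theorem fcc_ne_halfTurn_image :
    fccStacking 1 (Real.sqrt (2 / 3)) ≠
      (ℝ ∙ EuclideanSpace.single (2 : Fin 3) (1 : ℝ)).reflection '' fccStacking 1 (Real.sqrt (2 / 3)) := by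
  intro h
  set e₃ : EuclideanSpace ℝ (Fin 3) := EuclideanSpace.single (2 : Fin 3) (1 : ℝ) with he₃
  have he₃1 : ‖e₃‖ = 1 := by rw [he₃, PiLp.norm_single, norm_one]
  have hmenu : ∀ w ∈ fccSlots,
      ⟪(LinearIsometryEquiv.refl ℝ (EuclideanSpace ℝ (Fin 3))) w, e₃⟫_ℝ = 0 ∨
      ⟪(LinearIsometryEquiv.refl ℝ (EuclideanSpace ℝ (Fin 3))) w, e₃⟫_ℝ = Real.sqrt (2 / 3) ∨
      ⟪(LinearIsometryEquiv.refl ℝ (EuclideanSpace ℝ (Fin 3))) w, e₃⟫_ℝ = -Real.sqrt (2 / 3) := by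
    intro w hw
    rw [LinearIsometryEquiv.coe_refl, id, inner_single_two_one]
    exact slot_apply_two_cases hw
  obtain ⟨u, hu, _u₂, _hu₂, _u₃, _hu₃, hn, -⟩ :=
    exists_far_frame (LinearIsometryEquiv.refl ℝ (EuclideanSpace ℝ (Fin 3))) he₃1 hmenu
  rw [LinearIsometryEquiv.coe_refl, id, inner_single_two_one] at hn
  have hu2 : u 2 ≠ 0 := by rw [hn]; exact (Real.sqrt_pos.2 (by norm_num)).ne'
  have hmem : (ℝ ∙ e₃).reflection u ∈ fccStacking 1 (Real.sqrt (2 / 3)) := by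
    rw [h]; exact ⟨u, mem_fcc_of_mem_fccSlots hu, rfl⟩
  exact halfTurn_notMem_fccSlots hu hu2 (mem_fccSlots_of_unit hmem
    (by rw [LinearIsometryEquiv.norm_map, norm_eq_one_of_mem_fccSlots hu]))

open scoped Classical in
/-- **The flux-gap rung of `stub_coaxialTwoSlabAdhesion` (all co-axial pairs with `Λ₁ ≠ Λ₂`, general
fillings, `cos²θ ≥ 9/25`, modulo foreign twin dozens).**  See the module docstring. -/
theorem coaxialTwoSlabAdhesion_general_fluxGap {δ : ℝ} (hg : KissingGap δ) (hc : KissingClassification δ)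
    (A₁ : EuclideanSpace ℝ (Fin 3) ≃ₗᵢ[ℝ] EuclideanSpace ℝ (Fin 3)) (t₁ : EuclideanSpace ℝ (Fin 3))
    (A₂ : EuclideanSpace ℝ (Fin 3) ≃ₗᵢ[ℝ] EuclideanSpace ℝ (Fin 3)) (t₂ : EuclideanSpace ℝ (Fin 3))
    (L : EuclideanSpace ℝ (Fin 3) ≃ₗᵢ[ℝ] EuclideanSpace ℝ (Fin 3)) (s₁ s₂ : EuclideanSpace ℝ (Fin 3))
    (σ σ' : ℤ → ℤ) (hσ : IsHaggSeq σ) (hσ' : IsHaggSeq σ')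
    (hsub₁ : (fun p => A₁ p + t₁) '' fccStacking 1 (Real.sqrt (2 / 3)) ⊆
      (fun p => L p + s₁) '' barlowStacking 1 (Real.sqrt (2 / 3)) σ)
    (hsub₂ : (fun p => A₂ p + t₂) '' fccStacking 1 (Real.sqrt (2 / 3)) ⊆
      (fun p => L p + s₂) '' barlowStacking 1 (Real.sqrt (2 / 3)) σ')
    (hne : (fun p => A₁ p + t₁) '' fccStacking 1 (Real.sqrt (2 / 3)) ≠
      (fun p => A₂ p + t₂) '' fccStacking 1 (Real.sqrt (2 / 3)))
    (hreg : 9 / 25 ≤ ⟪L (EuclideanSpace.single (2 : Fin 3) (1 : ℝ)),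
      (EuclideanSpace.single (2 : Fin 3) (1 : ℝ))⟫_ℝ ^ 2) :
    ∃ C R₀ : ℝ, 1 ≤ R₀ ∧ ∀ h : ℝ, 0 ≤ h → ∀ ρ : ℝ, R₀ ≤ ρ →
      ∀ X P₁ P₂ : Finset (EuclideanSpace ℝ (Fin 3)),
      (∀ p ∈ X, ∀ q ∈ X, p ≠ q → 1 ≤ dist p q) → P₁ ⊆ X → P₂ ⊆ X \ P₁ →
      (∀ p ∈ X, -(2 * R₀) ≤ p 2 ∧ p 2 ≤ h + 2 * R₀ ∧ p 0 ^ 2 + p 1 ^ 2 ≤ ρ ^ 2) →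
      (∀ p, p ∈ P₁ ↔ (p ∈ (fun q => A₁ q + t₁) '' fccStacking 1 (Real.sqrt (2 / 3)) ∧
        -(2 * R₀) ≤ p 2 ∧ p 2 ≤ -R₀ ∧ p 0 ^ 2 + p 1 ^ 2 ≤ ρ ^ 2)) →
      (∀ p, p ∈ P₂ ↔ (p ∈ (fun q => A₂ q + t₂) '' fccStacking 1 (Real.sqrt (2 / 3)) ∧
        h + R₀ ≤ p 2 ∧ p 2 ≤ h + 2 * R₀ ∧ p 0 ^ 2 + p 1 ^ 2 ≤ ρ ^ 2)) →
      ((((P₁ ×ˢ (X \ P₁)).filter fun pq => dist pq.1 pq.2 = 1).card : ℕ) : ℝ) +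
        ((((P₂ ×ˢ ((X \ P₁) \ P₂)).filter fun pq => dist pq.1 pq.2 = 1).card : ℕ) : ℝ) ≤
        contactDeficiency ((X \ P₁) \ P₂) +
          (Real.sqrt 2 / 4 * ∑ᶠ w ∈ {w ∈ fccStacking 1 (Real.sqrt (2 / 3)) | ‖w‖ = 1},
              |⟪w, A₁.symm (EuclideanSpace.single (2 : Fin 3) (1 : ℝ))⟫_ℝ| +
            Real.sqrt 2 / 4 * ∑ᶠ w ∈ {w ∈ fccStacking 1 (Real.sqrt (2 / 3)) | ‖w‖ = 1},
              |⟪w, A₂.symm (EuclideanSpace.single (2 : Fin 3) (1 : ℝ))⟫_ℝ| -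
            (Real.sqrt 6 / 156 : ℝ) * Real.sqrt (1 - ⟪L (EuclideanSpace.single (2 : Fin 3) (1 : ℝ)),
              (EuclideanSpace.single (2 : Fin 3) (1 : ℝ))⟫_ℝ ^ 2)) * Real.pi * ρ ^ 2 +
          (1 / 26 : ℝ) * ((X.filter fun b =>
            ∃ G : EuclideanSpace ℝ (Fin 3) ≃ₗᵢ[ℝ] EuclideanSpace ℝ (Fin 3),
              (G = L ∨ G = (ℝ ∙ EuclideanSpace.single (2 : Fin 3) (1 : ℝ)).reflection.trans L) ∧
              ∃ n' : EuclideanSpace ℝ (Fin 3), ‖n'‖ = 1 ∧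
                n' ≠ L (EuclideanSpace.single (2 : Fin 3) (1 : ℝ)) ∧
                n' ≠ -L (EuclideanSpace.single (2 : Fin 3) (1 : ℝ)) ∧
                (∀ w ∈ fccSlots, ⟪G w, n'⟫_ℝ = 0 ∨ ⟪G w, n'⟫_ℝ = Real.sqrt (2 / 3) ∨
                  ⟪G w, n'⟫_ℝ = -Real.sqrt (2 / 3)) ∧
                (∀ w ∈ fccSlots, ⟪G w, n'⟫_ℝ ≤ 0 → b + G w ∈ X) ∧
                (∀ w ∈ fccSlots, ⟪G w, n'⟫_ℝ < 0 → b + (G w - (2 * ⟪G w, n'⟫_ℝ) • n') ∈ X) ∧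
                (∀ w ∈ fccSlots, 0 < ⟪G w, n'⟫_ℝ → b + G w ∉ X)).card : ℝ) +
          C * (1 + h) * ρ := by
  by_cases htw : σ 0 = σ' 0
  · exact coaxialTwoSlabAdhesion_general_trans_fluxGap hg hc A₁ t₁ A₂ t₂ L s₁ s₂ σ σ' hσ hσ' hsub₁ hsub₂
      htw hne hreg
  · have htwin : A₁ '' fccStacking 1 (Real.sqrt (2 / 3)) ≠ A₂ '' fccStacking 1 (Real.sqrt (2 / 3)) := by
      intro heq
      obtain ⟨-, f₁⟩ := linear_image_eq_frame_of_subset A₁ L t₁ s₁ hσ hsub₁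
      obtain ⟨-, f₂⟩ := linear_image_eq_frame_of_subset A₂ L t₂ s₂ hσ' hsub₂
      have hinj : Function.Injective (fun S : Set (EuclideanSpace ℝ (Fin 3)) => L '' S) :=
        Set.image_injective.2 L.injective
      rcases hσ 0 with h1 | h1 <;> rcases hσ' 0 with h2 | h2
      · exact htw (h1.trans h2.symm)
      · rw [h1] at f₁; rw [h2] at f₂
        have key := hinj (f₁.symm.trans (heq.trans f₂))
        exact fcc_ne_halfTurn_image (key.trans barlowStacking_negConst_eq_halfTurn_image)
      · rw [h1] at f₁; rw [h2] at f₂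
        have key := hinj (f₂.symm.trans (heq.symm.trans f₁))
        exact fcc_ne_halfTurn_image (key.trans barlowStacking_negConst_eq_halfTurn_image)
      · exact htw (h1.trans h2.symm)
    exact coaxialTwoSlabAdhesion_general_twin_fluxGap hg hc A₁ t₁ A₂ t₂ L s₁ s₂ σ σ' hσ hσ' hsub₁ hsub₂
      htwin hreg

end Summit.Ventures.Crystal3D.Theorems

end
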